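import Mathlib
import HarnessLib
import Summits.HubbardSuperconductivity.HubbardSuperconductivity.Theorems.KLProgrammeKLRegimeEngineV17F2ClosersVGQOutC
import Summits.HubbardSuperconductivity.HubbardSuperconductivity.Theorems.KLProgrammeKLRegimeEngineV17F2ClosersVGQIso
import Summits.HubbardSuperconductivity.HubbardSuperconductivity.Theorems.KLProgrammeKLRegimeEngineV17F2ClosersVGQLad

/-!
# K3 ENGINE (stmt-HubbardSuperconductivity-20437 `KLRegimeEngineV17F2`, V2 registration 27cd7ed0f55f17c0), row (c) `stub_engine_step_values`:
# THE (c) CREDIT SHAPE `…_pkg₅` — row (c) VERBATIM modulo class #5's resolvent-tower package and the (c)-OUT package with p2's frame shift folded in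
# (cell gate-hubbard-kl, seat hubbard-kl-k3c2-p2 g24; composes `…ClosersVGQOutC` (`rowC_hexOut_of_pkgγ`), `…VGQLad` (`rowC_hexLad_of_pkg`), `…VGQIso` (`…_of_producers₂`))

**`A24a1G14.stub_engine_step_values_of_producers_pkg₅ hexLadPkg hexOutPkgγ : <row (c) of the V2 image VERBATIM>`** — the residual of row (c) = TWO ∃-packages whose rows
are E1's / class #5's only: `hexLadPkg` (a-priori array bound + the resolvent tower at in-class `Qm`), `hexOutPkgγ` (per out-of-class `Qm` and `x, y` on the ball: `Z ≠ 0`,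
(N₄-PATH), RH/RL, (E4)-dressed split + pins + windows, self-energy, size fits, shares; the class-#5 relative datum in regime (β) only; the frame-shift inputs — two `Z` facts,
sizes `(a, n₆, s₂, n₄)`, room line, three kernel rows below the last index / `IsUnit Z` + `a` at it).  HYPOTHESES, not assertions; NOT a stub credit until both packages are
theorems; nothing here asserts (c), any open row of 20437, K3 or superconductivity.  0 kit · 0 lit.
-/

noncomputable section

/-! ## Row (c) of the V2 image VERBATIM modulo the two ∃-packages -/

namespace Summit.HubbardSuperconductivity.HubbardSuperconductivity.Theorems.EngineV8.A24a1G14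

set_option linter.dupNamespace false -- summit = problem name (single-conjunct summit), D-0017

open Real Set Finset Complex Matrix Literature.MathematicalPhysics.QuantumLattice GrassmannAlgebra
open Literature.Probability.LatticeModels hiding torusSupNorm
open Literature.MathematicalPhysics.QuantumLattice.BandSectorCounting
open Summit.HubbardSuperconductivity.HubbardSuperconductivity.Theorems.KLProgrammeLegKernels
open Summit.HubbardSuperconductivity.HubbardSuperconductivity.Theorems.KLRegimeWick
open Summit.HubbardSuperconductivity.HubbardSuperconductivity.Theorems.TwoPointAssembly
open Summit.HubbardSuperconductivity.HubbardSuperconductivity.Theorems.DispersionFlow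
open Summit.HubbardSuperconductivity.HubbardSuperconductivity.Theorems.PerturbedFermiCurve
open Summit.HubbardSuperconductivity.HubbardSuperconductivity.Theorems.KLRegimeSplit
open Summit.HubbardSuperconductivity.HubbardSuperconductivity.Theorems.EngineV8

/-- **THE (c) CREDIT SHAPE, regime (α) of the relative datum AND the frame shift DISCHARGED** — row (c) of the V2 image 27cd7ed0f55f17c0 VERBATIM modulo `hexLadPkg` (class #5's resolvent tower,
`…ClosersVGQLad`) and `hexOutPkgγ` (= `…ClosersVGQOutB`'s package with p2's `hshift` row REPLACED by its producers' inputs: below the last index the two `Z` facts,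
the four sizes `(a, n₆, s₂, n₄)` with the room line and the three kernel rows of `hshift_succ_of_sizes_geom`; at the last index `IsUnit Z(Kₙ₊₁)` + the size `a` of
`hshift_lastScale_succ_of_size`).  HYPOTHESES, not assertions; NOT a stub credit until both packages are theorems. -/
theorem stub_engine_step_values_of_producers_pkg₅
    (hexLadPkg : ∀ (P : SplitConsts) (R : RenConsts) (c : ℝ), P.WF → R.WF2 → 0 < c → c ≤ klEngC₃7GU klEngGeo14 P R →
          ∀ μ ∈ klWindowC, ∀ U : ℝ, 0 < U → U ≤ klEngU₀12GQ klEngGeo14 (klEngQ9dG klEngGeo14 P R) P R c → ∀ β : ℝ, klBetaMin ≤ β → β ≤ Real.exp (c / U ^ 2) →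
            ∀ (L M : ℕ) [NeZero L] [NeZero M], klEngL₄ P R β U ≤ L → klEngM₃ β U L ≤ M →
              ∀ n : ℕ, 1 ≤ n → n ≤ nScales β + 1 → IsKLRegime U c (-(n : ℤ)) →
                HistP klPredsV17F2 L M klEngGeo14 P (klEngQ9dG klEngGeo14 P R) R β U μ 0 n →
                  FrameOK R U (nScales β) μ (klFlowFrameU L M β U μ n) →
                    KernelNormsV4 L M P (klEngQ9dG klEngGeo14 P R) β U μ (klFlowFrameU L M β U μ n) n →
                      (∀ j ≤ n, (KernelNormsLevels L M P (klEngQ9dG klEngGeo14 P R) β U μ (klFlowFrameU L M β U μ n) j ∧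
                        KernelNormsWt4 L M (klWtBudget P (klEngQ9dG klEngGeo14 P R) U j) β U μ (klFlowFrameU L M β U μ n) j)) →
                        (∀ j ≤ n, LevelsUExportMixedAt L M (klCU2 P R (klEngQ7 P R)) P β U μ j) →
                          (∀ j ≤ n, IsoTupleLineBAt L M klE5AM klE5cM (klE5dM P R) P β U μ j) →
                            (∀ j ≤ n, PairTransferRelFamilyK5 L M klEngGeoTh P (klCT8 P R (klEngQ7 P R) klEngGeo14 klEngGeoTh) β U μ j) →
            ∃ m : ℝ, 0 ≤ m ∧ (∀ Qm s t, ‖klPairArrayF L M β U μ (n - 1) Qm s t‖ ≤ m) ∧ m * (klEngGeo14.bhi / 4) ≤ 1 / 3 ∧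
              (∀ Qm : TorusSite 2 L, IsPairClassAt L Qm n → ∃ (X Nm : Matrix (TorusSite 2 L) (TorusSite 2 L) ℂ) (w₁ : TorusSite 2 L → ℝ) (Ea E₁ : TorusSite 2 L → TorusSite 2 L → ℝ) (r' e₁ : ℝ), 0 ≤ r' ∧ 0 ≤ e₁ ∧ (∀ x y, ¬(x ∈ klBall L μ 0 ∧ y ∈ klBall L μ 0) → X x y = 0) ∧ (∀ k ∈ klBall L μ 0, ∀ k' ∈ klBall L μ 0, X k
                  k' = klCovSmearedPairAmplitude L M β U μ (klFlowFrameU L M β U μ (n - 1)) (n - 1) (softCovOf L M β μ (klFlowFrameU L M β U μ (n - 1)) (softSymbolCompl L M β μ (klFlowFrameU L M β U μ (n - 1)) (n - 1) n)) Qm k k') ∧ (∀ x y, 0 ≤ Ea x y) ∧ (1 + Matrix.diagonal (fun p => (w₁ p : ℂ)) * X) * Nm = 1 ∧ (∀ k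
                  ∈ klBall L μ 0, ∀ k' ∈ klBall L μ 0, ‖klPairArrayF L M β U μ n Qm k k' - (X * Nm) k k'‖ ≤ Ea k k') ∧ (∀ x y, transferBarRelIdx L klEngGeoTh P (klCT8 P R (klEngQ7 P R) klEngGeo14 klEngGeoTh) β U (n - 1) (n - 1) Qm x y ≤ r') ∧ (∀ x y, Ea x y + (transferBarRelIdx L klEngGeoTh P (klCT8 P R (klEngQ7 P R)
                  klEngGeo14 klEngGeoTh) β U (n - 1) (n - 1) Qm x y + 3 / 2 * (3 / 2 * m) * ∑ t, transferBarRelIdx L klEngGeoTh P (klCT8 P R (klEngQ7 P R) klEngGeo14 klEngGeoTh) β U (n - 1) (n - 1) Qm x t * |w₁ t| + 3 / 2 * (3 / 2 * m + r') * ∑ a, |w₁ a| * transferBarRelIdx L klEngGeoTh P (klCT8 P R (klEngQ7 P R)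
                  klEngGeo14 klEngGeoTh) β U (n - 1) (n - 1) Qm a y + 9 / 4 * (3 / 2 * m + r') * (3 / 2 * m) * ∑ a, ∑ t, |w₁ a| * transferBarRelIdx L klEngGeoTh P (klCT8 P R (klEngQ7 P R) klEngGeo14 klEngGeoTh) β U (n - 1) (n - 1) Qm a t * |w₁ t|) ≤ E₁ x y) ∧ (∀ x y, E₁ x y ≤ e₁) ∧ (3 / 2 * m + r') * ∑ a, |w₁ a| ≤ 1 /
                  3 ∧ (∑ p, |w₁ p| ≤ 3 / 4 * klEngGeo14.bhi) ∧ (∑ p, (|w₁ p| - w₁ p) ≤ klEdge klEngGeo14 n (klTorusNorm L Qm)) ∧ (∀ k ∈ klBall L μ 0, ∀ k' ∈ klBall L μ 0, E₁ k k' ≤ drivePBar klEngGeo14 P U (n - 1) + eremBar klEngGeo14 P (klEngQ9dG klEngGeo14 P R) U β L (n - 1) + thermalBar klEngGeo14 P U β n +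
                  legDressBarQ2 klEngGeo14 P (klEngQ9dG klEngGeo14 P R) U n (legSliceCountT L β μ (klFlowFrameU L M β U μ n) n ![k', Qm - k', Qm - k, k]) + (P.Klam * U) ^ 2 * (klEngGeo14.phGain n (klTorusNorm L (k - k')) + klEngGeo14.phGain n (klTorusNorm L (k + k' - Qm))) + frameShiftBar P (klEngQ9dG klEngGeo14 P R)
                  U n)))
    (hexOutPkg :
      ∀ (P : SplitConsts) (R : RenConsts) (c : ℝ), P.WF → R.WF2 → 0 < c → c ≤ klEngC₃7GU klEngGeo14 P R →
        ∀ μ ∈ klWindowC, ∀ U : ℝ, 0 < U → U ≤ klEngU₀12GQ klEngGeo14 (klEngQ9dG klEngGeo14 P R) P R c → ∀ β : ℝ, klBetaMin ≤ β → β ≤ Real.exp (c / U ^ 2) →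
          ∀ (L M : ℕ) [NeZero L] [NeZero M], klEngL₄ P R β U ≤ L → klEngM₃ β U L ≤ M →
            ∀ n' : ℕ, 1 ≤ n' → n' ≤ nScales β + 1 → IsKLRegime U c (-(n' : ℤ)) →
              HistP klPredsV17F2 L M klEngGeo14 P (klEngQ9dG klEngGeo14 P R) R β U μ 0 n' →
                FrameOK R U (nScales β) μ (klFlowFrameU L M β U μ n') →
                  KernelNormsV4 L M P (klEngQ9dG klEngGeo14 P R) β U μ (klFlowFrameU L M β U μ n') n' →
                    (∀ j ≤ n', (KernelNormsLevels L M P (klEngQ9dG klEngGeo14 P R) β U μ (klFlowFrameU L M β U μ n') j ∧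
                      KernelNormsWt4 L M (klWtBudget P (klEngQ9dG klEngGeo14 P R) U j) β U μ (klFlowFrameU L M β U μ n') j)) →
                      (∀ j ≤ n', LevelsUExportMixedAt L M (klCU2 P R (klEngQ7 P R)) P β U μ j) →
                        (∀ j ≤ n', IsoTupleLineBAt L M klE5AM klE5cM (klE5dM P R) P β U μ j) →
                          (∀ j ≤ n', PairTransferRelFamilyK5 L M klEngGeoTh P (klCT8 P R (klEngQ7 P R) klEngGeo14 klEngGeoTh) β U μ j) →
          ∀ n : ℕ, n' = n + 1 → ∀ Qm : TorusSite 2 L, ¬ IsPairClassAt L Qm (n + 1) → ∀ x ∈ klBall L μ 0, ∀ y ∈ klBall L μ 0,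
            ∀ j : ℕ, j = n + 1 →
            ∀ (A A' : ℕ → TorusSite 2 L → ℝ → Matrix (TorusSite 2 L) (TorusSite 2 L) ℂ) (b' : ℕ → TorusSite 2 L → ℝ → TorusSite 2 L → ℂ),
              (A = fun j Qm t => Matrix.of fun k k' : TorusSite 2 L => if k ∈ klBall L μ 0 ∧ k' ∈ klBall L μ 0 then vertexFn L M β (gaussConv ℂ (softCovOf L M β μ (klFlowFrameU L M β U μ n) (softSymbolCompl L M β μ (klFlowFrameU L M β U μ n) (n + 1) j) + hubbardCovAboveCT L M β μ 0 (klFlowFrameU L M β U μ n) (klScale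
                  klE0 (n + 1)) - hubbardCovAboveCT L M β μ 0 (klFlowFrameU L M β U μ n) (klScale klE0 n + t * (klScale klE0 (n + 1) - klScale klE0 n))) (hubbardEffectiveActionCT L M β U μ 0 (klFlowFrameU L M β U μ n) (klScale klE0 n + t * (klScale klE0 (n + 1) - klScale klE0 n)))) 4 ![(((omega0 M, k'), 0), 0),
                  ((((omega0 M).rev, Qm - k'), 1), 0), ((((omega0 M).rev, Qm - k), 1), 1), (((omega0 M, k), 0), 1)] else 0) →
              (A' = fun j Qm t => Matrix.of fun k k' : TorusSite 2 L => if k ∈ klBall L μ 0 ∧ k' ∈ klBall L μ 0 then (klScale klE0 (n + 1) - klScale klE0 n) • -((2 : ℂ)⁻¹ * vertexFn L M β (gaussConv ℂ (softCovOf L M β μ (klFlowFrameU L M β U μ n) (softSymbolCompl L M β μ (klFlowFrameU L M β U μ n) (n + 1) j) +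
                  hubbardCovAboveCT L M β μ 0 (klFlowFrameU L M β U μ n) (klScale klE0 (n + 1)) - hubbardCovAboveCT L M β μ 0 (klFlowFrameU L M β U μ n) (klScale klE0 n + t * (klScale klE0 (n + 1) - klScale klE0 n))) (grassmannDerivPairing ℂ (Matrix.of fun X Y : HubbardFieldIdx L M => deriv (fun Λ'' : ℝ =>
                  hubbardCovAboveCT L M β μ 0 (klFlowFrameU L M β U μ n) Λ'' X Y) (klScale klE0 n + t * (klScale klE0 (n + 1) - klScale klE0 n))) (hubbardEffectiveActionCT L M β U μ 0 (klFlowFrameU L M β U μ n) (klScale klE0 n + t * (klScale klE0 (n + 1) - klScale klE0 n))) (hubbardEffectiveActionCT L M β U μ 0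
                  (klFlowFrameU L M β U μ n) (klScale klE0 n + t * (klScale klE0 (n + 1) - klScale klE0 n))))) 4 ![(((omega0 M, k'), 0), 0), ((((omega0 M).rev, Qm - k'), 1), 0), ((((omega0 M).rev, Qm - k), 1), 1), (((omega0 M, k), 0), 1)]) else 0) →
              (b' = fun (j : ℕ) (Qm : TorusSite 2 L) (t : ℝ) (p : TorusSite 2 L) => (((klScale klE0 (n + 1) - klScale klE0 n) * (klBubbleMass L M β μ (klFlowFrameU L M β U μ n) (fun k => deriv (fun Λ' => hubbardCutoffWeightCT L M β μ (klFlowFrameU L M β U μ n) Λ' k) (klScale klE0 n + t * (klScale klE0 (n + 1) -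
                  klScale klE0 n))) (fun k => (softSymbolCompl L M β μ (klFlowFrameU L M β U μ n) (n + 1) j) k + (hubbardCutoffWeightCT L M β μ (klFlowFrameU L M β U μ n) (klScale klE0 (n + 1)) k - hubbardCutoffWeightCT L M β μ (klFlowFrameU L M β U μ n) (klScale klE0 n + t * (klScale klE0 (n + 1) - klScale klE0 n))
                  k)) Qm p + klBubbleMass L M β μ (klFlowFrameU L M β U μ n) (fun k => (softSymbolCompl L M β μ (klFlowFrameU L M β U μ n) (n + 1) j) k + (hubbardCutoffWeightCT L M β μ (klFlowFrameU L M β U μ n) (klScale klE0 (n + 1)) k - hubbardCutoffWeightCT L M β μ (klFlowFrameU L M β U μ n) (klScale klE0 n + t *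
                  (klScale klE0 (n + 1) - klScale klE0 n)) k)) (fun k => deriv (fun Λ' => hubbardCutoffWeightCT L M β μ (klFlowFrameU L M β U μ n) Λ' k) (klScale klE0 n + t * (klScale klE0 (n + 1) - klScale klE0 n))) Qm p) : ℝ) : ℂ)) →
            ∀ (V : ℕ → ℝ → (Fin 4 → HubbardFieldIdx L M) → ℂ), (V = fun j t X => vertexFn L M β (gaussConv ℂ (softCovOf L M β μ (klFlowFrameU L M β U μ n) (softSymbolCompl L M β μ (klFlowFrameU L M β U μ n) (n + 1) j) + hubbardCovAboveCT L M β μ 0 (klFlowFrameU L M β U μ n) (klScale klE0 (n + 1)) - hubbardCovAboveCT L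
                M β μ 0 (klFlowFrameU L M β U μ n) (klScale klE0 n + t * (klScale klE0 (n + 1) - klScale klE0 n))) (hubbardEffectiveActionCT L M β U μ 0 (klFlowFrameU L M β U μ n) (klScale klE0 n + t * (klScale klE0 (n + 1) - klScale klE0 n)))) 4 X) →
            ∀ (V6 : ℕ → ℝ → (Fin 6 → HubbardFieldIdx L M) → ℂ), (V6 = fun j t X => vertexFn L M β (gaussConv ℂ (softCovOf L M β μ (klFlowFrameU L M β U μ n) (softSymbolCompl L M β μ (klFlowFrameU L M β U μ n) (n + 1) j) + hubbardCovAboveCT L M β μ 0 (klFlowFrameU L M β U μ n) (klScale klE0 (n + 1)) - hubbardCovAboveCT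
                L M β μ 0 (klFlowFrameU L M β U μ n) (klScale klE0 n + t * (klScale klE0 (n + 1) - klScale klE0 n))) (hubbardEffectiveActionCT L M β U μ 0 (klFlowFrameU L M β U μ n) (klScale klE0 n + t * (klScale klE0 (n + 1) - klScale klE0 n)))) 6 X) →
            ∀ (Sg : ℕ → ℝ → FreqMomentum L M → Fin 2 → ℂ), (Sg = fun j t p σ => selfEnergy L M β (gaussConv ℂ (softCovOf L M β μ (klFlowFrameU L M β U μ n) (softSymbolCompl L M β μ (klFlowFrameU L M β U μ n) (n + 1) j) + hubbardCovAboveCT L M β μ 0 (klFlowFrameU L M β U μ n) (klScale klE0 (n + 1)) - hubbardCovAboveCT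
                L M β μ 0 (klFlowFrameU L M β U μ n) (klScale klE0 n + t * (klScale klE0 (n + 1) - klScale klE0 n))) (hubbardEffectiveActionCT L M β U μ 0 (klFlowFrameU L M β U μ n) (klScale klE0 n + t * (klScale klE0 (n + 1) - klScale klE0 n)))) p σ) →
            ∀ (Hd : ℕ → ℝ → (Fin 4 → HubbardFieldIdx L M) → ℂ), (Hd = fun j t X => vertexFn L M β (dblFold ℂ (grassmannLaplacian ℂ (crossCov ℂ (Matrix.of fun X Y : HubbardFieldIdx L M => deriv (fun Λ' : ℝ => hubbardCovAboveCT L M β μ 0 (klFlowFrameU L M β U μ n) Λ' X Y) (klScale klE0 n + t * (klScale klE0 (n + 1) -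
                klScale klE0 n)))) ((gaussConv ℂ (crossCov ℂ (softCovOf L M β μ (klFlowFrameU L M β U μ n) (softSymbolCompl L M β μ (klFlowFrameU L M β U μ n) (n + 1) j) + hubbardCovAboveCT L M β μ 0 (klFlowFrameU L M β U μ n) (klScale klE0 (n + 1)) - hubbardCovAboveCT L M β μ 0 (klFlowFrameU L M β U μ n) (klScale
                klE0 n + t * (klScale klE0 (n + 1) - klScale klE0 n)))) - grassmannLaplacian ℂ (crossCov ℂ (softCovOf L M β μ (klFlowFrameU L M β U μ n) (softSymbolCompl L M β μ (klFlowFrameU L M β U μ n) (n + 1) j) + hubbardCovAboveCT L M β μ 0 (klFlowFrameU L M β U μ n) (klScale klE0 (n + 1)) - hubbardCovAboveCT L M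
                β μ 0 (klFlowFrameU L M β U μ n) (klScale klE0 n + t * (klScale klE0 (n + 1) - klScale klE0 n))))) (dblCopy ℂ 0 (gaussConv ℂ (softCovOf L M β μ (klFlowFrameU L M β U μ n) (softSymbolCompl L M β μ (klFlowFrameU L M β U μ n) (n + 1) j) + hubbardCovAboveCT L M β μ 0 (klFlowFrameU L M β U μ n) (klScale
                klE0 (n + 1)) - hubbardCovAboveCT L M β μ 0 (klFlowFrameU L M β U μ n) (klScale klE0 n + t * (klScale klE0 (n + 1) - klScale klE0 n))) (hubbardEffectiveActionCT L M β U μ 0 (klFlowFrameU L M β U μ n) (klScale klE0 n + t * (klScale klE0 (n + 1) - klScale klE0 n)))) * dblCopy ℂ 1 (gaussConv ℂ (softCovOf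
                L M β μ (klFlowFrameU L M β U μ n) (softSymbolCompl L M β μ (klFlowFrameU L M β U μ n) (n + 1) j) + hubbardCovAboveCT L M β μ 0 (klFlowFrameU L M β U μ n) (klScale klE0 (n + 1)) - hubbardCovAboveCT L M β μ 0 (klFlowFrameU L M β U μ n) (klScale klE0 n + t * (klScale klE0 (n + 1) - klScale klE0 n)))
                (hubbardEffectiveActionCT L M β U μ 0 (klFlowFrameU L M β U μ n) (klScale klE0 n + t * (klScale klE0 (n + 1) - klScale klE0 n)))))))) 4 X) →
            ∀ (Φ : ℕ → ℝ → FreqMomentum L M → ℝ), (Φ = fun j t k => (softSymbolCompl L M β μ (klFlowFrameU L M β U μ n) (n + 1) j) k + (hubbardCutoffWeightCT L M β μ (klFlowFrameU L M β U μ n) (klScale klE0 (n + 1)) k - hubbardCutoffWeightCT L M β μ (klFlowFrameU L M β U μ n) (klScale klE0 n + t * (klScale klE0 (n +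
                1) - klScale klE0 n)) k)) →
            ∀ (Wd : ℝ → FreqMomentum L M → ℝ), (Wd = fun t k => deriv (fun Λ' : ℝ => hubbardCutoffWeightCT L M β μ (klFlowFrameU L M β U μ n) Λ' k) (klScale klE0 n + t * (klScale klE0 (n + 1) - klScale klE0 n))) →
            ∀ (Br : ℕ → TorusSite 2 L → ℝ → TorusSite 2 L × MatsubaraIdx M → ℂ), (Br = fun j Qm t z => -(((((β * (L : ℝ) ^ 2 : ℝ) : ℂ)))⁻¹ * propCT L M β μ (klFlowFrameU L M β U μ n) (z.2, z.1) * propCT L M β μ (klFlowFrameU L M β U μ n) (z.2.rev, Qm - z.1)) * ((((klScale klE0 (n + 1) - klScale klE0 n) * (-Wd t (z.2,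
                z.1) * Φ j t (z.2.rev, Qm - z.1) - Φ j t (z.2, z.1) * Wd t (z.2.rev, Qm - z.1))) : ℝ) : ℂ)) →
            ∃ (c₄ RH RL : ℝ) (c₀ : ℂ) (F₁ F₂ : ℝ → FreqMomentum L M → Fin 2 → FreqMomentum L M → ℂ) (F₁₀ : ℝ → TorusSite 2 L → Fin 2 → TorusSite 2 L → ℂ) (Fx₁ Fx₂ : ℝ → FreqMomentum L M → FreqMomentum L M → ℂ) (Fx₁₀ : ℝ → TorusSite 2 L → TorusSite 2 L → ℂ) (A₁ L₁ ε₁ : ℝ) (cen cenx : TorusSite 2 L) (ρw A₂ : ℝ) (A₀S LAS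
                εS : ℝ),
              (∀ Λ ∈ Icc (klScale klE0 (n + 1)) (klScale klE0 n), hubbardEffPartitionFnCT L M β U μ 0 (klFlowFrameU L M β U μ n) Λ ≠ 0) ∧
              (∀ t ∈ Icc (0 : ℝ) 1, ∀ X, ‖V j t X‖ ≤ c₄ * U) ∧
              c₄ ^ 2 ≤ 2 ^ 3 * P.Klam ^ 2 ∧
              (∀ t ∈ Icc (0 : ℝ) 1, ‖Hd j t ![(((omega0 M, y), 0), 0), ((((omega0 M).rev, Qm - y), 1), 0), ((((omega0 M).rev, Qm - x), 1), 1), (((omega0 M, x), 0), 1)]‖ ≤ RH) ∧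
              (∀ t ∈ Icc (0 : ℝ) 1, ‖∑ z : TorusSite 2 L × MatsubaraIdx M, Br j Qm t z * ((if z.1 ∈ klBall L μ 0 then V j t ![(((omega0 M, z.1), 0), 0), ((((omega0 M).rev, Qm - z.1), 1), 0), ((((omega0 M).rev, Qm - x), 1), 1), (((omega0 M, x), 0), 1)] * V j t ![(((omega0 M, y), 0), 0), ((((omega0 M).rev, Qm - y), 1),
                  0), ((((omega0 M).rev, Qm - z.1), 1), 1), (((omega0 M, z.1), 0), 1)] else 0) - V j t ![(((z.2, z.1), 0), 0), (((z.2.rev, Qm - z.1), 1), 0), ((((omega0 M).rev, Qm - x), 1), 1), (((omega0 M, x), 0), 1)] * V j t ![(((omega0 M, y), 0), 0), ((((omega0 M).rev, Qm - y), 1), 0), (((z.2.rev, Qm - z.1), 1),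
                  1), (((z.2, z.1), 0), 1)])‖ ≤ RL) ∧
              (∀ t ∈ Icc (0 : ℝ) 1, ∀ (p : FreqMomentum L M) (σ : Fin 2) (p' : FreqMomentum L M), V j t ![((p, σ), 1), ((p', σ), 0), (((omega0 M, y), 0), 0), (((omega0 M, x), 0), 1)] * V j t ![((p, σ), 0), ((p', σ), 1), ((((omega0 M).rev, Qm - y), 1), 0), ((((omega0 M).rev, Qm - x), 1), 1)] = c₀ + F₁ t p σ p' + F₂ t p
                  σ p') ∧
              (∀ t ∈ Icc (0 : ℝ) 1, ∀ (p p' : FreqMomentum L M), V j t ![((p, 0), 1), ((p', 1), 0), (((omega0 M, y), 0), 0), ((((omega0 M).rev, Qm - x), 1), 1)] * V j t ![((p, 0), 0), ((p', 1), 1), ((((omega0 M).rev, Qm - y), 1), 0), (((omega0 M, x), 0), 1)] = c₀ + Fx₁ t p p' + Fx₂ t p p') ∧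
              (0 ≤ A₁) ∧
              (0 ≤ L₁) ∧
              (0 ≤ ε₁) ∧
              (∀ t ∈ Icc (0 : ℝ) 1, ∀ k : TorusSite 2 L, ‖∑ σ : Fin 2, F₁₀ t k σ (k + (x - y))‖ ≤ A₁) ∧
              (∀ t ∈ Icc (0 : ℝ) 1, ∀ k k' : TorusSite 2 L, ‖(∑ σ : Fin 2, F₁₀ t k σ (k + (x - y))) - ∑ σ : Fin 2, F₁₀ t k' σ (k' + (x - y))‖ ≤ L₁ * klTorusNorm L (k - k')) ∧
              (∀ t ∈ Icc (0 : ℝ) 1, ∀ k : TorusSite 2 L, ‖∑ σ : Fin 2, F₁₀ t (k + -(x - y)) σ k‖ ≤ A₁) ∧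
              (∀ t ∈ Icc (0 : ℝ) 1, ∀ k k' : TorusSite 2 L, ‖(∑ σ : Fin 2, F₁₀ t (k + -(x - y)) σ k) - ∑ σ : Fin 2, F₁₀ t (k' + -(x - y)) σ k'‖ ≤ L₁ * klTorusNorm L (k - k')) ∧
              (∀ t ∈ Icc (0 : ℝ) 1, ∀ (i : MatsubaraIdx M) (σ : Fin 2) (k k' : TorusSite 2 L), matsubaraFreq β M i ^ 2 ≤ (4 * klScale klE0 (n + 1)) ^ 2 → ‖F₁ t (i, k) σ (i, k') - F₁₀ t k σ k'‖ ≤ ε₁) ∧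
              (∀ t ∈ Icc (0 : ℝ) 1, ∀ k : TorusSite 2 L, ‖Fx₁₀ t k (k + (Qm - x - y))‖ ≤ A₁) ∧
              (∀ t ∈ Icc (0 : ℝ) 1, ∀ k k' : TorusSite 2 L, ‖Fx₁₀ t k (k + (Qm - x - y)) - Fx₁₀ t k' (k' + (Qm - x - y))‖ ≤ L₁ * klTorusNorm L (k - k')) ∧
              (∀ t ∈ Icc (0 : ℝ) 1, ∀ k : TorusSite 2 L, ‖Fx₁₀ t (k + -(Qm - x - y)) k‖ ≤ A₁) ∧
              (∀ t ∈ Icc (0 : ℝ) 1, ∀ k k' : TorusSite 2 L, ‖Fx₁₀ t (k + -(Qm - x - y)) k - Fx₁₀ t (k' + -(Qm - x - y)) k'‖ ≤ L₁ * klTorusNorm L (k - k')) ∧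
              (∀ t ∈ Icc (0 : ℝ) 1, ∀ (i i' : MatsubaraIdx M) (k k' : TorusSite 2 L), matsubaraInt M i' + 1 = matsubaraInt M i → matsubaraFreq β M i ^ 2 ≤ (5 * klScale klE0 (n + 1)) ^ 2 → ‖Fx₁ t (i, k) (i', k') - Fx₁₀ t k k'‖ ≤ ε₁) ∧
              (0 ≤ ρw) ∧
              (0 ≤ A₂) ∧
              (∀ t ∈ Icc (0 : ℝ) 1, ∀ (p : FreqMomentum L M) (σ : Fin 2) (p' : FreqMomentum L M), ‖F₂ t p σ p'‖ ≤ A₂) ∧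
              (∀ t ∈ Icc (0 : ℝ) 1, ∀ (p : FreqMomentum L M) (σ : Fin 2) (p' : FreqMomentum L M), ρw < klTorusNorm L (p.2 - cen) → F₂ t p σ p' = 0) ∧
              (∀ t ∈ Icc (0 : ℝ) 1, ∀ (p p' : FreqMomentum L M), ‖Fx₂ t p p'‖ ≤ A₂) ∧
              (∀ t ∈ Icc (0 : ℝ) 1, ∀ (p p' : FreqMomentum L M), ρw < klTorusNorm L (p.2 - cenx) → Fx₂ t p p' = 0) ∧
              (0 ≤ A₀S) ∧
              (0 ≤ LAS) ∧
              (0 ≤ εS) ∧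
              (∀ t ∈ Icc (0 : ℝ) 1, ∀ k : TorusSite 2 L, ‖∑ σ : Fin 2, V6 j t ![(((omega0 M, k), σ), 0), (((omega0 M, k), σ), 1), (((omega0 M, y), 0), 0), ((((omega0 M).rev, Qm - y), 1), 0), ((((omega0 M).rev, Qm - x), 1), 1), (((omega0 M, x), 0), 1)] * Sg j t (omega0 M, k) σ‖ ≤ A₀S) ∧
              (∀ t ∈ Icc (0 : ℝ) 1, ∀ k k' : TorusSite 2 L, ‖(∑ σ : Fin 2, V6 j t ![(((omega0 M, k), σ), 0), (((omega0 M, k), σ), 1), (((omega0 M, y), 0), 0), ((((omega0 M).rev, Qm - y), 1), 0), ((((omega0 M).rev, Qm - x), 1), 1), (((omega0 M, x), 0), 1)] * Sg j t (omega0 M, k) σ) - ∑ σ : Fin 2, V6 j t ![(((omega0 M,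
                  k'), σ), 0), (((omega0 M, k'), σ), 1), (((omega0 M, y), 0), 0), ((((omega0 M).rev, Qm - y), 1), 0), ((((omega0 M).rev, Qm - x), 1), 1), (((omega0 M, x), 0), 1)] * Sg j t (omega0 M, k') σ‖ ≤ LAS * klTorusNorm L (k - k')) ∧
              (∀ t ∈ Icc (0 : ℝ) 1, ∀ (i : MatsubaraIdx M) (σ : Fin 2) (k : TorusSite 2 L), matsubaraFreq β M i ^ 2 ≤ (4 * klScale klE0 (n + 1)) ^ 2 → ‖V6 j t ![(((i, k), σ), 0), (((i, k), σ), 1), (((omega0 M, y), 0), 0), ((((omega0 M).rev, Qm - y), 1), 0), ((((omega0 M).rev, Qm - x), 1), 1), (((omega0 M, x), 0), 1)]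
                  * Sg j t (i, k) σ - V6 j t ![(((omega0 M, k), σ), 0), (((omega0 M, k), σ), 1), (((omega0 M, y), 0), 0), ((((omega0 M).rev, Qm - y), 1), 0), ((((omega0 M).rev, Qm - x), 1), 1), (((omega0 M, x), 0), 1)] * Sg j t (omega0 M, k) σ‖ ≤ εS) ∧
              ((393216 / Real.pi * (64 * (klScale klE0 (n + 1) / klScale klE0 j) ^ 2 + (2 * (448 / 3 * Real.exp 2) + 8) + 64) * (2 * A₀S * (Real.pi * Real.sqrt 2 / (cDtmin (-(6 / 5)) (-(1 / 10)) - 4 * (2 * R.Gfr 0 * |U| + 2 * R.Gfr 1 * U ^ 2 + R.Gfr 2 * (c / Real.log 4)))))) ≤ 2 ^ 77 * (P.Klam * U) ^ 2) ∧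
              ((524288 / Real.pi * (64 * (klScale klE0 (n + 1) / klScale klE0 j) ^ 2 + (2 * (448 / 3 * Real.exp 2) + 8) + 64) * (Real.pi * Real.sqrt 2 / (cDtmin (-(6 / 5)) (-(1 / 10)) - 4 * (2 * R.Gfr 0 * |U| + 2 * R.Gfr 1 * U ^ 2 + R.Gfr 2 * (c / Real.log 4))) * (2 * L₁ + 2 * (2 * ‖c₀‖ + A₁) * (2 / (1 / 10))) /
                  (cDtmin (-(6 / 5)) (-(1 / 10)) - 4 * (2 * R.Gfr 0 * |U| + 2 * R.Gfr 1 * U ^ 2 + R.Gfr 2 * (c / Real.log 4))) + 2 * (2 * ‖c₀‖ + A₁) * (1 / (cDtmin (-(6 / 5)) (-(1 / 10)) - 4 * (2 * R.Gfr 0 * |U| + 2 * R.Gfr 1 * U ^ 2 + R.Gfr 2 * (c / Real.log 4))) ^ 2 + Real.pi * Real.sqrt 2 * (2 + 4 * (2 * R.Gfr 0 *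
                  |U| + 2 * R.Gfr 1 * U ^ 2 + R.Gfr 2 * (c / Real.log 4))) / (cDtmin (-(6 / 5)) (-(1 / 10)) - 4 * (2 * R.Gfr 0 * |U| + 2 * R.Gfr 1 * U ^ 2 + R.Gfr 2 * (c / Real.log 4))) ^ 3))) ≤ 2 ^ 52 * (P.Klam * U) ^ 2) ∧
              ((393216 / Real.pi * (64 * (klScale klE0 (n + 1) / klScale klE0 j) ^ 2 + (2 * (448 / 3 * Real.exp 2) + 8) + 64) * (2 * (2 * ‖c₀‖ + A₁) * (Real.pi * Real.sqrt 2 / (cDtmin (-(6 / 5)) (-(1 / 10)) - 4 * (2 * R.Gfr 0 * |U| + 2 * R.Gfr 1 * U ^ 2 + R.Gfr 2 * (c / Real.log 4)))))) ≤ 2 ^ 76 * (P.Klam * U) ^ 2) ∧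
              ((393216 / Real.pi * (64 * (klScale klE0 (n + 1) / klScale klE0 j) ^ 2 + (2 * (448 / 3 * Real.exp 2) + 8) + 64) * (2 * (2 * ‖c₀‖ + A₁) * (Real.pi * Real.sqrt 2 / (cDtmin (-(6 / 5)) (-(1 / 10)) - 4 * (2 * R.Gfr 0 * |U| + 2 * R.Gfr 1 * U ^ 2 + R.Gfr 2 * (c / Real.log 4)))))) + 2 * (256 / Real.pi * 8 * (2 *
                  (2 * ‖c₀‖ + A₁) * (Real.pi * Real.sqrt 2 / (cDtmin (-(6 / 5)) (-(1 / 10)) - 4 * (2 * R.Gfr 0 * |U| + 2 * R.Gfr 1 * U ^ 2 + R.Gfr 2 * (c / Real.log 4))))) * (65 * (8 * (16 : ℝ) ^ (j - (n + 1))) + 17408 / 3 * 1)) ≤ 2 ^ 76 * (P.Klam * U) ^ 2) ∧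
              ((256 / Real.pi * 8 * (2 * (2 * ‖c₀‖ + A₁) * (Real.pi * Real.sqrt 2 / (cDtmin (-(6 / 5)) (-(1 / 10)) - 4 * (2 * R.Gfr 0 * |U| + 2 * R.Gfr 1 * U ^ 2 + R.Gfr 2 * (c / Real.log 4))))) * (65 * (8 * (16 : ℝ) ^ (j - (n + 1))) + 17408 / 3 * 1)) * (4 + 8 / 3 * R.Gfr 1 * U ^ 2) ≤ 2 ^ 52 * (P.Klam * U) ^ 2) ∧
              ((klScale klE0 n - klScale klE0 (n + 1)) * (2⁻¹ * RH) ≤ 4⁻¹ * (klEngGeo11.cloc * (P.Klam * U) ^ 2 * (4 : ℝ) ^ (-(klEngGeo11.θ * n)))) ∧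
              (RL ≤ 4⁻¹ * ((klEngQ9dG klEngGeo14 P R).CL β n / L)) ∧
              ((β ^ 2 + 1) * (2 ^ 18 * (L₁ + LAS / 2) + 2 ^ 30 * ((2 * ‖c₀‖ + A₁) + A₀S / 2) * (4 + 8 / 3 * R.Gfr 1 * U ^ 2) * (16 : ℝ) ^ (j - (n + 1))) ≤ 4⁻¹ * (klEngQ9dG klEngGeo14 P R).CL β n) ∧
              ((524288 / Real.pi * (64 * (klScale klE0 (n + 1) / klScale klE0 j) ^ 2 + (2 * (448 / 3 * Real.exp 2) + 8) + 64) * (Real.pi * Real.sqrt 2 / (cDtmin (-(6 / 5)) (-(1 / 10)) - 4 * (2 * R.Gfr 0 * |U| + 2 * R.Gfr 1 * U ^ 2 + R.Gfr 2 * (c / Real.log 4))) * (2 * LAS + 2 * A₀S * (2 / (1 / 10))) / (cDtmin (-(6 /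
                  5)) (-(1 / 10)) - 4 * (2 * R.Gfr 0 * |U| + 2 * R.Gfr 1 * U ^ 2 + R.Gfr 2 * (c / Real.log 4))) + 2 * A₀S * (1 / (cDtmin (-(6 / 5)) (-(1 / 10)) - 4 * (2 * R.Gfr 0 * |U| + 2 * R.Gfr 1 * U ^ 2 + R.Gfr 2 * (c / Real.log 4))) ^ 2 + Real.pi * Real.sqrt 2 * (2 + 4 * (2 * R.Gfr 0 * |U| + 2 * R.Gfr 1 * U ^ 2 +
                  R.Gfr 2 * (c / Real.log 4))) / (cDtmin (-(6 / 5)) (-(1 / 10)) - 4 * (2 * R.Gfr 0 * |U| + 2 * R.Gfr 1 * U ^ 2 + R.Gfr 2 * (c / Real.log 4))) ^ 3))) * klE0 ≤ 4 * 4⁻¹ * ((klEngQ9dG klEngGeo14 P R).CR * (P.Klam * |U|) ^ 3)) ∧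
              (2 * ((ε₁ * (2048 * 15367) + A₂ * (4096 * 15381) * (ρw / π + ((L : ℝ))⁻¹))) + 2 * (εS * (2048 * 15367)) ≤ 4⁻¹ * (klEngGeo11.cloc * (P.Klam * U) ^ 2 * (4 : ℝ) ^ (-(klEngGeo11.θ * n))) + 4⁻¹ * ((klEngQ9dG klEngGeo14 P R).CR * (P.Klam * |U|) ^ 3 * ((2 : ℝ) ^ n)⁻¹)) ∧
              (¬ IsPairClassAt L Qm n → ∃ N : Matrix (TorusSite 2 L) (TorusSite 2 L) ℂ, (1 - diagonal (fun p => ((klTransferWeight L M β μ (klFlowFrameU L M β U μ n) n (softSymbolCompl L M β μ (klFlowFrameU L M β U μ n) n (n + 1)) Qm p - klTransferWeight L M β μ (klFlowFrameU L M β U μ n) n (softSymbolCompl L M β μ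
                  (klFlowFrameU L M β U μ n) n n) Qm p : ℝ) : ℂ)) * klMemberArrayF L M β U μ n (softSymbolCompl L M β μ (klFlowFrameU L M β U μ n) n n) Qm) * N = 1 ∧ N * (1 - diagonal (fun p => ((klTransferWeight L M β μ (klFlowFrameU L M β U μ n) n (softSymbolCompl L M β μ (klFlowFrameU L M β U μ n) n (n + 1)) Qm p -
                  klTransferWeight L M β μ (klFlowFrameU L M β U μ n) n (softSymbolCompl L M β μ (klFlowFrameU L M β U μ n) n n) Qm p : ℝ) : ℂ)) * klMemberArrayF L M β U μ n (softSymbolCompl L M β μ (klFlowFrameU L M β U μ n) n n) Qm) = 1 ∧ ∀ k ∈ klBall L μ 0, ∀ k' ∈ klBall L μ 0, ‖klMemberArrayF L M β U μ n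
                  (softSymbolCompl L M β μ (klFlowFrameU L M β U μ n) n (n + 1)) Qm k k' - (klMemberArrayF L M β U μ n (softSymbolCompl L M β μ (klFlowFrameU L M β U μ n) n n) Qm * N) k k'‖ ≤ (transferBarRelIdx L klEngGeoTh P (klCT8 P R (klEngQ7 P R) klEngGeo14 klEngGeoTh) β U n n) Qm k k') ∧
              ((n + 1 ≤ nScales β → ∀ (s₀ s₁ : FreqMomentum L M × Fin 2 → ℂ), (s₀ = uvSymbolCT L M β μ (klFlowFrameU L M β U μ n) (klScale klE0 (n + 1))) → (s₁ = fun ks => uvSymbolCT L M β μ (klFlowFrameU L M β U μ (n + 1)) (klScale klE0 (n + 1)) ks / (1 + uvSymbolCT L M β μ (klFlowFrameU L M β U μ (n + 1)) (klScale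
                  klE0 (n + 1)) ks * (((fsub (klFlowFrameU L M β U μ (n + 1)) (klFlowFrameU L M β U μ n)).eval (latticeMomentum L ks.1.2) / (β * (L : ℝ) ^ 2) : ℝ) : ℂ))) → ∃ (a n₆ s₂ n₄ : ℝ), (effPartitionFn ℂ (normalCovariance L M (uvSymbolCT L M β μ (klFlowFrameU L M β U μ (n + 1)) (klScale klE0 (n + 1))))
                  (hubbardInteraction L M β U + counterQuadratic L M β (klFlowFrameU L M β U μ (n + 1))) ≠ 0) ∧ (∀ t ∈ Set.Icc (0 : ℝ) 1, effPartitionFn ℂ (normalCovariance L M s₀ + ((t : ℂ)) • (normalCovariance L M s₁ - normalCovariance L M s₀)) (hubbardInteraction L M β U + counterQuadratic L M β (klFlowFrameU L M β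
                  U μ n)) ≠ 0) ∧ 0 ≤ a ∧ a ≤ 2 ^ 28 ∧ 0 ≤ n₆ ∧ 0 ≤ s₂ ∧ 0 ≤ n₄ ∧ (547400 * (8 / Real.pi * 2946 * n₆ + 4 * s₂ * n₄) ≤ klHshiftC) ∧ (‖klPairAmplitude L M β U μ (klFlowFrameU L M β U μ (n + 1)) (n + 1) Qm x y‖ ≤ a * (P.Klam * |U|)) ∧ (∀ t ∈ Set.Icc (0 : ℝ) 1, ∀ A : HubbardFieldIdx L M, ‖kernel ℂ
                  (effAction ℂ (normalCovariance L M s₀ + ((t : ℂ)) • (normalCovariance L M s₁ - normalCovariance L M s₀)) (hubbardInteraction L M β U + counterQuadratic L M β (klFlowFrameU L M β U μ n))) 6 (Fin.snoc (Fin.snoc ![(((omega0 M, y), 0), 0), ((((omega0 M).rev, Qm - y), 1), 0), ((((omega0 M).rev, Qm - x),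
                  1), 1), (((omega0 M, x), 0), 1)] (A.1, 1 - A.2) : Fin 5 → HubbardFieldIdx L M) A)‖ ≤ n₆ * (P.Klam * U) ^ 2 / klScale klE0 (n + 1) / (720 * (β * (L : ℝ) ^ 2) ^ 5)) ∧ (∀ t ∈ Set.Icc (0 : ℝ) 1, ∀ i : Fin 4, |nambuXiCT L μ (klFlowFrameU L M β U μ n) ((![(((omega0 M, y), 0), 0), ((((omega0 M).rev, Qm -
                  y), 1), 0), ((((omega0 M).rev, Qm - x), 1), 1), (((omega0 M, x), 0), 1)] : Fin 4 → HubbardFieldIdx L M) i).1.1.2| < 5 * klScale klE0 (n + 1) / 4 → ‖kernel ℂ (effAction ℂ (normalCovariance L M s₀ + ((t : ℂ)) • (normalCovariance L M s₁ - normalCovariance L M s₀)) (hubbardInteraction L M β U +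
                  counterQuadratic L M β (klFlowFrameU L M β U μ n))) 2 ![((((![(((omega0 M, y), 0), 0), ((((omega0 M).rev, Qm - y), 1), 0), ((((omega0 M).rev, Qm - x), 1), 1), (((omega0 M, x), 0), 1)] : Fin 4 → HubbardFieldIdx L M) i).1, 1 - ((![(((omega0 M, y), 0), 0), ((((omega0 M).rev, Qm - y), 1), 0), ((((omega0
                  M).rev, Qm - x), 1), 1), (((omega0 M, x), 0), 1)] : Fin 4 → HubbardFieldIdx L M) i).2) : HubbardFieldIdx L M), (![(((omega0 M, y), 0), 0), ((((omega0 M).rev, Qm - y), 1), 0), ((((omega0 M).rev, Qm - x), 1), 1), (((omega0 M, x), 0), 1)] : Fin 4 → HubbardFieldIdx L M) i]‖ ≤ s₂ * |U| * klScale klE0 (n +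
                  1) / (2 * (β * (L : ℝ) ^ 2))) ∧ (∀ t ∈ Set.Icc (0 : ℝ) 1, ‖kernel ℂ (effAction ℂ (normalCovariance L M s₀ + ((t : ℂ)) • (normalCovariance L M s₁ - normalCovariance L M s₀)) (hubbardInteraction L M β U + counterQuadratic L M β (klFlowFrameU L M β U μ n))) 4 ![(((omega0 M, y), 0), 0), ((((omega0
                  M).rev, Qm - y), 1), 0), ((((omega0 M).rev, Qm - x), 1), 1), (((omega0 M, x), 0), 1)]‖ ≤ n₄ * (P.Klam * |U|) / (24 * (β * (L : ℝ) ^ 2) ^ 3))) ∧ (n = nScales β → ∃ a : ℝ, (IsUnit (effPartitionFn ℂ (normalCovariance L M (uvSymbolCT L M β μ (klFlowFrameU L M β U μ (n + 1)) (klScale klE0 (n + 1))))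
                  (hubbardInteraction L M β U + counterQuadratic L M β (klFlowFrameU L M β U μ (n + 1))))) ∧ 0 ≤ a ∧ a ≤ 2 ^ 28 ∧ (‖klPairAmplitude L M β U μ (klFlowFrameU L M β U μ (n + 1)) (n + 1) Qm x y‖ ≤ a * (P.Klam * |U|))))) :
    ∀ (P : SplitConsts) (R : RenConsts) (c : ℝ), P.WF → R.WF2 → 0 < c → c ≤ klEngC₃7GU klEngGeo14 P R →
      ∀ μ ∈ klWindowC, ∀ U : ℝ, 0 < U → U ≤ klEngU₀12GQ klEngGeo14 (klEngQ9dG klEngGeo14 P R) P R c → ∀ β : ℝ, klBetaMin ≤ β → β ≤ Real.exp (c / U ^ 2) →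
        ∀ (L M : ℕ) [NeZero L] [NeZero M], klEngL₄ P R β U ≤ L → klEngM₃ β U L ≤ M →
          ∀ n : ℕ, 1 ≤ n → n ≤ nScales β + 1 → IsKLRegime U c (-(n : ℤ)) →
            HistP klPredsV17F2 L M klEngGeo14 P (klEngQ9dG klEngGeo14 P R) R β U μ 0 n →
              FrameOK R U (nScales β) μ (klFlowFrameU L M β U μ n) →
                KernelNormsV4 L M P (klEngQ9dG klEngGeo14 P R) β U μ (klFlowFrameU L M β U μ n) n →
                  (∀ j ≤ n, (KernelNormsLevels L M P (klEngQ9dG klEngGeo14 P R) β U μ (klFlowFrameU L M β U μ n) j ∧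
                    KernelNormsWt4 L M (klWtBudget P (klEngQ9dG klEngGeo14 P R) U j) β U μ (klFlowFrameU L M β U μ n) j)) →
                    (∀ j ≤ n, LevelsUExportMixedAt L M (klCU2 P R (klEngQ7 P R)) P β U μ j) →
                      (∀ j ≤ n, IsoTupleLineBAt L M klE5AM klE5cM (klE5dM P R) P β U μ j) →
                        (∀ j ≤ n, PairTransferRelFamilyK5 L M klEngGeoTh P (klCT8 P R (klEngQ7 P R) klEngGeo14 klEngGeoTh) β U μ j) →
                  PairLadderStepAtV17F2 L M klEngGeo14 P (klEngQ9dG klEngGeo14 P R) β U μ n ∧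
                    PairValueIncrementAtV17F L M klEngGeo14 P (klEngQ9dG klEngGeo14 P R) β U μ n ∧
                      QuarticValueIncrementAtV17F L M klEngGeo14 P (klEngQ9dG klEngGeo14 P R) β U μ n ∧
                        IsoTupleL1AtV17F L M klEngGeo14 P β U μ n :=
  stub_engine_step_values_of_producers₂ (rowC_hexLad_of_pkg hexLadPkg) (rowC_hexOut_of_pkgγ hexOutPkg)

end Summit.HubbardSuperconductivity.HubbardSuperconductivity.Theorems.EngineV8.A24a1G14

end
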